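import Summits.BirchSwinnertonDyer.BirchSwinnertonDyer.Theorems.ThetaPartnerAtTwoSignedKatoUpToAtTwoLayerPairingModDefs
import Literature.NumberTheory.EllipticCurves.ZpExtensionGaloisTwistLocalKummer
import HarnessLib

/-!
# Route `ResidualThetaTransportAtTwo` (RTT P6, item stmt-BirchSwinnertonDyer-23110, road T), ISO brick (4) = (R):
# a class of the twisted signed local Kummer condition `L_u` RESTRICTS to the layer group `U_m` (`m ≥ J`) as an UNTWISTED
# `U_m`-cocycle of `E[p^J]|` with the SAME `G_∞`-witness

Seat `prover-bsd-wall-tp2-p2x` g12 LEAD (`--supports stmt-BirchSwinnertonDyer-23110`). THEOREMS ONLY (no definition, no named fact, no `sorry`);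
closes nothing; BSD is NOT proved by any of this.

In the lead's ISO programme (memo v5) and w2 g16's assembly plan (bus 21:43Z, (B4) `TwistedLocalKummer.iso_of_layerIso`:
«hiso(u) ⟸ LAYER-ISO(J) + (R)»), (R) is the statement that a class `y ∈ L_u = twistedTorsionLocalKummer p κ J u hu ℚ_v A` — by definition
(`mem_twistedTorsionLocalKummer_iff`) a Γ_{ℚ_v}-cocycle `ξ` of `E[p^J](χ_u)|` with a `G_∞`-WITNESS `(Q, k)`: `p^k Q ∈ A` and
`ξ(τ) = τQ − Q` on `G_∞ = localSubgroup (ker κ) ℚ_v` — restricts to the layer group `U_m = layerGroup κ v m` (`m ≥ J`, so `G_∞ ≤ U_m` and the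
twist is trivial on `U_m`, `galoisTwist_apply_of_mem_layerSubgroup`) as an honest `U_m`-cocycle of the UNTWISTED K3 coefficient module
`torsionLocalRep W (p^J) v = E[p^J]|` with the same values and the same witness:

* `localSubgroup_le_layerGroup` — `G_∞ ≤ U_m`;
* **`exists_layer_cocycle_of_mem_twistedTorsionLocalKummer`** — for `J ≤ m` and `y ∈ L_u(A)`: a cocycle
  `ψ ∈ Z¹(U_m, E[p^J]|)` and a representative `ξ` of `y` with `ψ(τ) = ξ(τ)` for all `τ ∈ U_m`, and `(Q, k)` with `p^k Q ∈ A`,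
  `ψ(τ) = τQ − Q` (as points) for all `τ ∈ G_∞`.

References: [GreenbergLNM1716] §4 p. 107; [BDKim2007] Prop. 3.15; [Kobayashi2003] Def. 1.1.
-/

-- the Theorems namespace of this sub repeats the summit name by design (D-0017 nested layout)
set_option linter.dupNamespace false

noncomputable section

open scoped Classical Topology

namespace Summit.BirchSwinnertonDyer.BirchSwinnertonDyer.Theorems.SignedEC.TwistLayer

open CategoryTheory Field NumberField IsDedekindDomain WeierstrassCurve Literature.NumberTheory.EllipticCurves
  Literature.NumberTheory.GaloisRepresentations ZpExtension
open Summit.BirchSwinnertonDyer.BirchSwinnertonDyer.Theorems.SignedKatoOffTwo.LayerPairing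

variable {p : ℕ} [Fact p.Prime] (κ : ZpExtension ℚ p) (v : HeightOneSpectrum (𝓞 ℚ))

/-- `G_∞ = Gal(ℚ̄_v/ℚ_{∞,v}) ≤ U_m = Gal(ℚ̄_v/ℚ_{m,v})` (`ker κ ≤ κ⁻¹(p^m ℤ_p)`). [cite: Kobayashi2003, Def. 1.1] -/
theorem localSubgroup_le_layerGroup (m : ℕ) :
    localSubgroup κ.kerSubgroup (v.adicCompletion ℚ) ≤ layerGroup κ v m := by
  intro τ hτ
  rw [localSubgroup, mem_localSubgroupOfEmb_iff] at hτ
  exact (mem_localSubgroupOfEmb_iff _ _ τ).2 (κ.kerSubgroup_le_layerSubgroup m hτ)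

/-- **(R): restriction of a class of `L_u` to the layer group is an untwisted layer cocycle with the same `G_∞`-witness.** For `J ≤ m`
and `y ∈ twistedTorsionLocalKummer p κ J u hu ℚ_v A`: there are a representative `ξ ∈ Z¹(Γ_{ℚ_v}, E[p^J](χ_u)|)` of `y`, an UNTWISTED
layer cocycle `ψ ∈ Z¹(U_m, E[p^J]|)` (`torsionLocalRep W (p^J) v`) with `ψ(τ) = ξ(τ)` on `U_m`, and a witness `(Q, k)`, `p^k • Q ∈ A`, with
`ψ(τ) = τ • Q − Q` (as points of `E(ℚ̄_v)`) for every `τ ∈ G_∞`. [cite: GreenbergLNM1716, §4 p. 107] [cite: BDKim2007, Prop. 3.15] -/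
theorem exists_layer_cocycle_of_mem_twistedTorsionLocalKummer (W : WeierstrassCurve ℚ) [W.IsElliptic] {J m : ℕ} (hJm : J ≤ m)
    (u : ℤ) (hu : (p : ℤ) ∣ u - 1) (A : AddSubgroup (localPoints W (v.adicCompletion ℚ)))
    {y : galoisCohomology ((W.twistedTorsionGaloisModule p κ J u hu).restrictField (v.adicCompletion ℚ)) 1}
    (hy : y ∈ W.twistedTorsionLocalKummer p κ J u hu (v.adicCompletion ℚ) A) :
    ∃ (ξ : contOneCocycles ((W.twistedTorsionGaloisModule p κ J u hu).restrictField (v.adicCompletion ℚ)).toTopRep)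
      (ψ : contOneCocycles (subgroupRep (torsionLocalRep W (p ^ J) v) (layerGroup κ v m)))
      (Q : localPoints W (v.adicCompletion ℚ)) (k : ℕ),
      oneCocycleClass _ ξ = y ∧
      (∀ τ : layerGroup κ v m, (ψ.1 τ : W.geomTorsion ((p ^ J : ℕ) : ℤ)) = ξ.1 (τ : absoluteGaloisGroup (v.adicCompletion ℚ))) ∧
      p ^ k • Q ∈ A ∧
      ∀ τ : localSubgroup κ.kerSubgroup (v.adicCompletion ℚ),
        pointsMap W (v.adicCompletion ℚ)
            ((ψ.1 ⟨(τ : absoluteGaloisGroup (v.adicCompletion ℚ)), localSubgroup_le_layerGroup κ v m τ.2⟩ :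
              W.geomTorsion ((p ^ J : ℕ) : ℤ)) : W.geomPoints) =
          (τ : absoluteGaloisGroup (v.adicCompletion ℚ)) • Q - Q := by
  obtain ⟨ξ, Q, k, hξ, hA, hwit⟩ := (W.mem_twistedTorsionLocalKummer_iff (p := p) (κ := κ) (J := J) (u := u) (hu := hu) A y).1 hy
  -- on `U_m` the twisted action is the untwisted one
  have hρ : ∀ (τ : layerGroup κ v m) (x : W.geomTorsion ((p ^ J : ℕ) : ℤ)),
      (W.twistedTorsionGaloisModule p κ J u hu) (absGaloisRestrict ℚ (v.adicCompletion ℚ) (τ : absoluteGaloisGroup (v.adicCompletion ℚ))) x =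
        (W.torsionGaloisModule ((p ^ J : ℕ) : ℤ)) (absGaloisRestrict ℚ (v.adicCompletion ℚ) (τ : absoluteGaloisGroup (v.adicCompletion ℚ))) x := by
    intro τ x
    have h1 : (τ : absoluteGaloisGroup (v.adicCompletion ℚ)) ∈ layerGroup κ v m := τ.2
    rw [mem_localSubgroupOfEmb_iff, ← resGal_eq, resGal_eq_absGaloisRestrict] at h1
    exact κ.galoisTwist_apply_of_mem_layerSubgroup (W.torsionGaloisModule ((p ^ J : ℕ) : ℤ)) J (W.pow_nsmul_geomTorsion_pow p J) u hu
      (κ.layerSubgroup_antitone hJm h1) x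
  -- the restricted cocycle, read with untwisted coefficients
  let ψ : contOneCocycles (subgroupRep (torsionLocalRep W (p ^ J) v) (layerGroup κ v m)) :=
    ⟨⟨fun τ ↦ ξ.1 (τ : absoluteGaloisGroup (v.adicCompletion ℚ)), ξ.1.continuous.comp continuous_subtype_val⟩, fun g h ↦ by
      change ξ.1 ((g : absoluteGaloisGroup (v.adicCompletion ℚ)) * (h : absoluteGaloisGroup (v.adicCompletion ℚ))) =
        ξ.1 (g : absoluteGaloisGroup (v.adicCompletion ℚ)) +
          (W.torsionGaloisModule ((p ^ J : ℕ) : ℤ)) (absGaloisRestrict ℚ (v.adicCompletion ℚ) (g : absoluteGaloisGroup (v.adicCompletion ℚ)))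
            (ξ.1 (h : absoluteGaloisGroup (v.adicCompletion ℚ)))
      rw [ξ.2, ← hρ g]
      rfl⟩
  exact ⟨ξ, ψ, Q, k, hξ, fun τ ↦ rfl, hA, fun τ ↦ hwit τ⟩

end Summit.BirchSwinnertonDyer.BirchSwinnertonDyer.Theorems.SignedEC.TwistLayer

end
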